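import Summits.RiemannHypothesis.RiemannHypothesis.Theorems.PfPersistenceParitySplitLaw
import HarnessLib

/-!
# Prime-indexed persistence — the GENERAL TEST-VECTOR parity-splitting law (cand-6, gen 7, rider)

Mechanism/rigidity campaign; **no RH claims**.  RH-free, `sorry`-free, no new definitions.

`PfPersistenceParitySplitLaw` (76b595021861) certifies that a `p`-dial `Q + t·S` (`S = diag((−1)^i)`, `t = (1 − K)·w(p)`,
mirror window `a = log p`) leaves the floored nodeless reader once `(1 − δ)·t` exceeds the PARITY-SPLITTING GAP
`g = λ_min(Q | odd-supported) − ε₁(Q)`, the test vector being supported on the lowered parity class (`vᵀSv = −‖v‖²`).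

This file removes the support restriction: for ANY test vector `v ≠ 0` with a Rayleigh bound `vᵀQv ≤ ℓ‖v‖²` and a
PARITY BOUND `vᵀSv ≤ s‖v‖²` (`s = 2·m_kept(v) − 1 ∈ [−1, 1]`), and any `t ≥ 0`,

* `ε₁(Q + t·S) ≤ ℓ + t·s` (`bottomRayleigh_add_smul_signDiag_le_gen`);
* every bottom vector `u` of `Q + t·S` has `t·uᵀSu ≤ (ℓ + t·s − ε₁(Q))‖u‖²` (`paritySplit_bottom_gen`);
* hence if `ℓ − ε₁(Q) < (−s − δ)·t` no bottom vector has parity defect `uᵀSu ≥ −δ‖u‖²` (`paritySplit_contra_gen`), and with the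
  SHARP floored parity-mass laws the dial is NOT in `floorNodelessAt φ` / `floorNodelessOddAt φ` / `floorNodelessEOAt φ` at its
  mirror window (`downDial_not_mem_floorNodelessAt_of_testVector`, `upDial_not_mem_floorNodelessOddAt_of_testVector`, EO twins);
* negativity along the same vector: `vᵀQv + t·vᵀSv < 0` ⇒ not window-positive and detectably negative (`dial_negative_of_testVector`).

The landed law is the case `s = −1` (`signDiag_form_le_of_oddSupported` supplies the parity bound; the landed
rejection theorem is then `downDial_not_mem_floorNodelessAt_of_testVector` with `s = −1`, not restated here).  NUMBER OF RECORD (DATA side, not in this file): the generalised gap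
`g⋆(Q, δ) = inf { (vᵀQv/‖v‖² − ε₁(Q)) / (−vᵀSv/‖v‖² − δ) : vᵀSv < −δ‖v‖² }`, which may be evaluated on the span of the two
softest eigenvectors of `Q` (a parity-MIXED plane) where the support-restricted gap is blind.

All statements are finite-dimensional linear algebra over an arbitrary weight table; nothing is asserted about `ζ`. [folklore]
-/

set_option linter.dupNamespace false  -- the mandated namespace repeats `RiemannHypothesis`

noncomputable section

open Real Set Matrix Finset

namespace Summit.RiemannHypothesis.RiemannHypothesis.Theorems.PfPersistence

/-! ## §1 The bottom of `Q + t·S` under a general test vector -/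

/-- PROVED: `ε₁(Q + t·S)·‖v‖² ≤ vᵀQv + t·vᵀSv` for every vector `v`. [folklore] -/
theorem bottomRayleigh_add_smul_signDiag_mul_le {m : ℕ} (Q : Matrix (Fin m) (Fin m) ℝ) (t : ℝ) (v : Fin m → ℝ) :
    bottomRayleigh (Q + t • signDiag m) * (v ⬝ᵥ v) ≤ v ⬝ᵥ (Q *ᵥ v) + t * (v ⬝ᵥ (signDiag m *ᵥ v)) := by
  have h := bottomRayleigh_mul_le_form (Q + t • signDiag m) v
  rwa [form_add_smul_signDiag] at h

/-- **PROVED:** for `t ≥ 0`, a test vector `v ≠ 0` with Rayleigh bound `ℓ` and parity bound `s` (`vᵀSv ≤ s‖v‖²`) gives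
`ε₁(Q + t·S) ≤ ℓ + t·s`. [folklore] -/
theorem bottomRayleigh_add_smul_signDiag_le_gen {m : ℕ} (Q : Matrix (Fin m) (Fin m) ℝ) {t : ℝ} (ht : 0 ≤ t)
    {v : Fin m → ℝ} (hv0 : v ≠ 0) {ℓ s : ℝ} (hℓ : v ⬝ᵥ (Q *ᵥ v) ≤ ℓ * (v ⬝ᵥ v))
    (hs : v ⬝ᵥ (signDiag m *ᵥ v) ≤ s * (v ⬝ᵥ v)) :
    bottomRayleigh (Q + t • signDiag m) ≤ ℓ + t * s := by
  have hvv : 0 < v ⬝ᵥ v :=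
    lt_of_le_of_ne (dotProduct_self_nonneg_real v) fun h => hv0 (dotProduct_self_eq_zero.1 h.symm)
  have h := bottomRayleigh_add_smul_signDiag_mul_le Q t v
  have h2 : t * (v ⬝ᵥ (signDiag m *ᵥ v)) ≤ t * (s * (v ⬝ᵥ v)) := mul_le_mul_of_nonneg_left hs ht
  have h' : bottomRayleigh (Q + t • signDiag m) * (v ⬝ᵥ v) ≤ (ℓ + t * s) * (v ⬝ᵥ v) := by linarith
  exact le_of_mul_le_mul_right h' hvv

/-- PROVED: the parity bound of an odd-supported vector is `s = −1` (the landed law's case). [folklore] -/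
theorem signDiag_form_le_of_oddSupported {m : ℕ} {v : Fin m → ℝ} (hv : ∀ i : Fin m, Even (i : ℕ) → v i = 0) :
    v ⬝ᵥ (signDiag m *ᵥ v) ≤ (-1) * (v ⬝ᵥ v) := by
  rw [dotProduct_signDiag_mulVec_of_oddSupported hv]; ring_nf; rfl

/-- PROVED (even sector): the parity bound in terms of the kept (even-indexed) mass — `vᵀSv ≤ s‖v‖²` iff
`2‖v^{ev}‖² ≤ (1 + s)‖v‖²`. [folklore] -/
theorem signDiag_form_le_iff_evenMass {N : ℕ} (v : Fin (N + 1) → ℝ) (s : ℝ) :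
    v ⬝ᵥ (signDiag (N + 1) *ᵥ v) ≤ s * (v ⬝ᵥ v) ↔ 2 * (evenIdxPart v ⬝ᵥ evenIdxPart v) ≤ (1 + s) * (v ⬝ᵥ v) := by
  rw [dotProduct_signDiag_mulVec_even]; constructor <;> intro h <;> linarith

/-! ## §2 The general law for a bottom vector -/

/-- **PROVED — THE GENERAL LAW:** every bottom vector `u` of `Q + t·S` (`t ≥ 0`) satisfies
`t · uᵀSu ≤ (ℓ + t·s − ε₁(Q)) ‖u‖²` for every test vector with Rayleigh bound `ℓ` and parity bound `s`. [folklore] -/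
theorem paritySplit_bottom_gen {m : ℕ} (Q : Matrix (Fin m) (Fin m) ℝ) {t : ℝ} (ht : 0 ≤ t) {u : Fin m → ℝ}
    (hu : IsBottomVector (Q + t • signDiag m) u) {v : Fin m → ℝ} (hv0 : v ≠ 0) {ℓ s : ℝ}
    (hℓ : v ⬝ᵥ (Q *ᵥ v) ≤ ℓ * (v ⬝ᵥ v)) (hs : v ⬝ᵥ (signDiag m *ᵥ v) ≤ s * (v ⬝ᵥ v)) :
    t * (u ⬝ᵥ (signDiag m *ᵥ u)) ≤ (ℓ + t * s - bottomRayleigh Q) * (u ⬝ᵥ u) := by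
  have h1 := paritySplit_law Q hu.2
  have h2 := bottomRayleigh_add_smul_signDiag_le_gen Q ht hv0 hℓ hs
  have h3 : (bottomRayleigh (Q + t • signDiag m) - bottomRayleigh Q) * (u ⬝ᵥ u)
      ≤ (ℓ + t * s - bottomRayleigh Q) * (u ⬝ᵥ u) :=
    mul_le_mul_of_nonneg_right (by linarith) (dotProduct_self_nonneg_real u)
  exact h1.trans h3

/-- **PROVED — NO NEAR-BALANCED BOTTOM VECTOR PAST THE GENERAL GAP:** if `ℓ − ε₁(Q) < (−s − δ)·t` (`t ≥ 0`) then no bottom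
vector of `Q + t·S` has parity defect `uᵀSu ≥ −δ‖u‖²`. [folklore] -/
theorem paritySplit_contra_gen {m : ℕ} (Q : Matrix (Fin m) (Fin m) ℝ) {t δ : ℝ} (ht : 0 ≤ t) {u : Fin m → ℝ}
    (hu : IsBottomVector (Q + t • signDiag m) u) {v : Fin m → ℝ} (hv0 : v ≠ 0) {ℓ s : ℝ}
    (hℓ : v ⬝ᵥ (Q *ᵥ v) ≤ ℓ * (v ⬝ᵥ v)) (hs : v ⬝ᵥ (signDiag m *ᵥ v) ≤ s * (v ⬝ᵥ v))
    (hsplit : ℓ - bottomRayleigh Q < (-s - δ) * t) (hdef : -(δ * (u ⬝ᵥ u)) ≤ u ⬝ᵥ (signDiag m *ᵥ u)) : False := by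
  have huu : 0 < u ⬝ᵥ u :=
    lt_of_le_of_ne (dotProduct_self_nonneg_real u) fun h => hu.1 (dotProduct_self_eq_zero.1 h.symm)
  have h1 := paritySplit_bottom_gen Q ht hu hv0 hℓ hs
  have h2 : t * -(δ * (u ⬝ᵥ u)) ≤ t * (u ⬝ᵥ (signDiag m *ᵥ u)) := mul_le_mul_of_nonneg_left hdef ht
  have h3 : -(t * δ) * (u ⬝ᵥ u) ≤ (ℓ + t * s - bottomRayleigh Q) * (u ⬝ᵥ u) := by
    calc -(t * δ) * (u ⬝ᵥ u) = t * -(δ * (u ⬝ᵥ u)) := by ring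
      _ ≤ (ℓ + t * s - bottomRayleigh Q) * (u ⬝ᵥ u) := h2.trans h1
  have h4 : -(t * δ) ≤ ℓ + t * s - bottomRayleigh Q := le_of_mul_le_mul_right h3 huu
  linarith

/-- **PROVED (even sector, abstract):** past the general gap no bottom vector of `Q + t·S` (dimension `N+1`) is `φ`-floor
one-signed on a window of length `L > 0` (`δ = (2φ+φ²)(2N+1)`). [folklore] -/
theorem not_floorOneSigned_of_testVector {L φ : ℝ} (hL : 0 < L) (hφ : 0 ≤ φ) {N : ℕ}
    (Q : Matrix (Fin (N + 1)) (Fin (N + 1)) ℝ) {t : ℝ} (ht : 0 ≤ t) {u : Fin (N + 1) → ℝ}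
    (hu : IsBottomVector (Q + t • signDiag (N + 1)) u) {v : Fin (N + 1) → ℝ} (hv0 : v ≠ 0) {ℓ s : ℝ}
    (hℓ : v ⬝ᵥ (Q *ᵥ v) ≤ ℓ * (v ⬝ᵥ v)) (hs : v ⬝ᵥ (signDiag (N + 1) *ᵥ v) ≤ s * (v ⬝ᵥ v))
    (hsplit : ℓ - bottomRayleigh Q < (-s - (2 * φ + φ ^ 2) * (2 * N + 1)) * t) :
    ¬FloorOneSigned L φ u := by
  intro hfloor
  have hmass := parityMass_two_le_of_floorOneSigned hL hφ hfloor
  refine paritySplit_contra_gen Q ht hu hv0 hℓ hs hsplit ?_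
  rw [dotProduct_signDiag_mulVec_even]
  linarith

/-- **PROVED (odd sector, abstract):** the same with `Q` of dimension `N`, `δ = (2φ+φ²)·2N`. [folklore] -/
theorem not_floorOneSignedOdd_of_testVector {L φ : ℝ} (hL : 0 < L) (hφ : 0 ≤ φ) {N : ℕ}
    (Q : Matrix (Fin N) (Fin N) ℝ) {c : ℝ} (hc : 0 ≤ c) {u : Fin N → ℝ}
    (hu : IsBottomVector (Q + c • signDiag N) u) {v : Fin N → ℝ} (hv0 : v ≠ 0) {ℓ s : ℝ}
    (hℓ : v ⬝ᵥ (Q *ᵥ v) ≤ ℓ * (v ⬝ᵥ v)) (hs : v ⬝ᵥ (signDiag N *ᵥ v) ≤ s * (v ⬝ᵥ v))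
    (hsplit : ℓ - bottomRayleigh Q < (-s - (2 * φ + φ ^ 2) * (2 * N)) * c) :
    ¬FloorOneSignedOdd L φ u := by
  intro hfloor
  have hmass := parityMassOdd_two_le_of_floorOneSignedOdd hL hφ hfloor
  refine paritySplit_contra_gen Q hc hu hv0 hℓ hs hsplit ?_
  rw [dotProduct_signDiag_mulVec_odd]
  linarith

/-! ## §3 Dials at their mirror windows -/

/-- **PROVED — DOWN DIALS PAST THE GENERAL GAP ARE NODAL IN THE EVEN SECTOR AT THEIR MIRROR WINDOW.** For every weight table
`w`, slot `p ≥ 2`, window with `win.a = log p`, floor `φ ≥ 0`, size `t = (1 − K) w(p) ≥ 0`, and every test vector `v ≠ 0` with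
`vᵀQ⁺v ≤ ℓ‖v‖²`, `vᵀSv ≤ s‖v‖²` and `ℓ − ε₁(Q⁺) < (−s − (2φ+φ²)(2N+1))·t`: the dial is not in `floorNodelessAt φ win`. [folklore] -/
theorem downDial_not_mem_floorNodelessAt_of_testVector {p : ℕ} (hp : 2 ≤ p) {win : Window} (hwin : win.a = Real.log p)
    (w : Weights) {K φ : ℝ} (hφ : 0 ≤ φ) (ht : 0 ≤ (1 - K) * w p) {v : Fin (win.N + 1) → ℝ} (hv0 : v ≠ 0) {ℓ s : ℝ}
    (hℓ : v ⬝ᵥ (evenBlock w win *ᵥ v) ≤ ℓ * (v ⬝ᵥ v)) (hs : v ⬝ᵥ (signDiag (win.N + 1) *ᵥ v) ≤ s * (v ⬝ᵥ v))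
    (hsplit : ℓ - bottomRayleigh (evenBlock w win) < (-s - (2 * φ + φ ^ 2) * (2 * win.N + 1)) * ((1 - K) * w p)) :
    datumOf (dial p K w) ∉ floorNodelessAt φ win := by
  rintro ⟨u, hbv, hfloor⟩
  have hblock : datumOf (dial p K w) win = evenBlock w win + ((1 - K) * w p) • signDiag (win.N + 1) :=
    evenBlock_dial_mirror' hp hwin K w
  have hbv' : IsBottomVector (evenBlock w win + ((1 - K) * w p) • signDiag (win.N + 1)) u := by
    rw [← hblock]; exact hbv
  have ha : 0 < 2 * win.a := by linarith [win.ha]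
  exact not_floorOneSigned_of_testVector ha hφ (evenBlock w win) ht hbv' hv0 hℓ hs hsplit hfloor

/-- **PROVED — UP DIALS PAST THE GENERAL GAP ARE NODAL IN THE ODD SECTOR AT THEIR MIRROR WINDOW** (`Q⁻ = oddBlock w win`,
`c = (K − 1) w(p) ≥ 0`, `δ = (2φ+φ²)·2N`). [folklore] -/
theorem upDial_not_mem_floorNodelessOddAt_of_testVector {p : ℕ} (hp : 2 ≤ p) {win : Window} (hwin : win.a = Real.log p)
    (w : Weights) {K φ : ℝ} (hφ : 0 ≤ φ) (hc : 0 ≤ (K - 1) * w p) {v : Fin win.N → ℝ} (hv0 : v ≠ 0) {ℓ s : ℝ}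
    (hℓ : v ⬝ᵥ (oddBlock w win *ᵥ v) ≤ ℓ * (v ⬝ᵥ v)) (hs : v ⬝ᵥ (signDiag win.N *ᵥ v) ≤ s * (v ⬝ᵥ v))
    (hsplit : ℓ - bottomRayleigh (oddBlock w win) < (-s - (2 * φ + φ ^ 2) * (2 * win.N)) * ((K - 1) * w p)) :
    datumOf (dial p K w) ∉ floorNodelessOddAt φ win := by
  rintro ⟨u, hbv, hfloor⟩
  have hblock : oddDatum (datumOf (dial p K w)) win = oddBlock w win + ((K - 1) * w p) • signDiag win.N := by
    rw [oddDatum_datumOf, oddBlock_dial_mirror hp hwin]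
  have hbv' : IsBottomVector (oddBlock w win + ((K - 1) * w p) • signDiag win.N) u := by
    rw [← hblock]; exact hbv
  have ha : 0 < 2 * win.a := by linarith [win.ha]
  exact not_floorOneSignedOdd_of_testVector ha hφ (oddBlock w win) hc hbv' hv0 hℓ hs hsplit hfloor

/-- PROVED (two-parity handle, down sign). [folklore] -/
theorem downDial_not_mem_floorNodelessEOAt_of_testVector {p : ℕ} (hp : 2 ≤ p) {win : Window} (hwin : win.a = Real.log p)
    (w : Weights) {K φ : ℝ} (hφ : 0 ≤ φ) (ht : 0 ≤ (1 - K) * w p) {v : Fin (win.N + 1) → ℝ} (hv0 : v ≠ 0) {ℓ s : ℝ}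
    (hℓ : v ⬝ᵥ (evenBlock w win *ᵥ v) ≤ ℓ * (v ⬝ᵥ v)) (hs : v ⬝ᵥ (signDiag (win.N + 1) *ᵥ v) ≤ s * (v ⬝ᵥ v))
    (hsplit : ℓ - bottomRayleigh (evenBlock w win) < (-s - (2 * φ + φ ^ 2) * (2 * win.N + 1)) * ((1 - K) * w p)) :
    datumOf (dial p K w) ∉ floorNodelessEOAt φ win :=
  fun h => downDial_not_mem_floorNodelessAt_of_testVector hp hwin w hφ ht hv0 hℓ hs hsplit h.1

/-- PROVED (two-parity handle, up sign). [folklore] -/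
theorem upDial_not_mem_floorNodelessEOAt_of_testVector {p : ℕ} (hp : 2 ≤ p) {win : Window} (hwin : win.a = Real.log p)
    (w : Weights) {K φ : ℝ} (hφ : 0 ≤ φ) (hc : 0 ≤ (K - 1) * w p) {v : Fin win.N → ℝ} (hv0 : v ≠ 0) {ℓ s : ℝ}
    (hℓ : v ⬝ᵥ (oddBlock w win *ᵥ v) ≤ ℓ * (v ⬝ᵥ v)) (hs : v ⬝ᵥ (signDiag win.N *ᵥ v) ≤ s * (v ⬝ᵥ v))
    (hsplit : ℓ - bottomRayleigh (oddBlock w win) < (-s - (2 * φ + φ ^ 2) * (2 * win.N)) * ((K - 1) * w p)) :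
    datumOf (dial p K w) ∉ floorNodelessEOAt φ win :=
  fun h => upDial_not_mem_floorNodelessOddAt_of_testVector hp hwin w hφ hc hv0 hℓ hs hsplit h.2

/-! ## §4 Negativity along the same test vector -/

/-- **PROVED — NEGATIVITY ALONG A GENERAL TEST VECTOR:** if `vᵀQ⁺v + (1 − K) w(p) · vᵀSv < 0` then the dial (either sign of
`1 − K`) is not window-positive at its mirror window and is detectably negative (witness `v`). [folklore] -/
theorem dial_negative_of_testVector {p : ℕ} (hp : 2 ≤ p) {win : Window} (hwin : win.a = Real.log p) (w : Weights)
    {K : ℝ} {v : Fin (win.N + 1) → ℝ}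
    (hneg : v ⬝ᵥ (evenBlock w win *ᵥ v) + (1 - K) * w p * (v ⬝ᵥ (signDiag (win.N + 1) *ᵥ v)) < 0) :
    ¬WindowPositive (datumOf (dial p K w) win) ∧ DetectablyNegative (datumOf (dial p K w)) := by
  have hblock : datumOf (dial p K w) win = evenBlock w win + ((1 - K) * w p) • signDiag (win.N + 1) :=
    evenBlock_dial_mirror' hp hwin K w
  have hval : v ⬝ᵥ (datumOf (dial p K w) win *ᵥ v) < 0 := by
    rw [hblock, form_add_smul_signDiag]; exact hneg
  exact ⟨fun hW => absurd (hW v) (not_le.2 hval), win, v, hval⟩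

/-- PROVED (bounds form): `vᵀQ⁺v ≤ ℓ‖v‖²`, `vᵀSv ≤ s‖v‖²`, `t = (1 − K) w(p) ≥ 0`, `v ≠ 0` and `ℓ + t·s < 0` ⇒ not
window-positive and detectably negative. [folklore] -/
theorem downDial_negative_of_testBounds {p : ℕ} (hp : 2 ≤ p) {win : Window} (hwin : win.a = Real.log p) (w : Weights)
    {K : ℝ} (ht : 0 ≤ (1 - K) * w p) {v : Fin (win.N + 1) → ℝ} (hv0 : v ≠ 0) {ℓ s : ℝ}
    (hℓ : v ⬝ᵥ (evenBlock w win *ᵥ v) ≤ ℓ * (v ⬝ᵥ v)) (hs : v ⬝ᵥ (signDiag (win.N + 1) *ᵥ v) ≤ s * (v ⬝ᵥ v))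
    (hℓs : ℓ + (1 - K) * w p * s < 0) :
    ¬WindowPositive (datumOf (dial p K w) win) ∧ DetectablyNegative (datumOf (dial p K w)) := by
  have hvv : 0 < v ⬝ᵥ v :=
    lt_of_le_of_ne (dotProduct_self_nonneg_real v) fun h => hv0 (dotProduct_self_eq_zero.1 h.symm)
  refine dial_negative_of_testVector hp hwin w (v := v) ?_
  have h2 : (1 - K) * w p * (v ⬝ᵥ (signDiag (win.N + 1) *ᵥ v)) ≤ (1 - K) * w p * (s * (v ⬝ᵥ v)) :=
    mul_le_mul_of_nonneg_left hs ht
  have h3 : (ℓ + (1 - K) * w p * s) * (v ⬝ᵥ v) < 0 := mul_neg_of_neg_of_pos hℓs hvv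
  linarith

/-- **PROVED — NEGATIVE AND REJECTED (general test vector, down sign):** one test vector `v` with bounds `ℓ, s`, `s < 0`,
`t = (1 − K) w(p) ≥ 0`, `ℓ + t·s < 0` (negativity) and `ℓ − ε₁(Q⁺) < (−s − (2φ+φ²)(2N+1))·t` (splitting) makes the dial
detectably negative, not window-positive, and rejected by `floorNodelessAt φ` and `floorNodelessEOAt φ` at its mirror window. [folklore] -/
theorem downDial_negative_and_rejected_gen {p : ℕ} (hp : 2 ≤ p) {win : Window} (hwin : win.a = Real.log p)
    (w : Weights) {K φ : ℝ} (hφ : 0 ≤ φ) (ht : 0 ≤ (1 - K) * w p) {v : Fin (win.N + 1) → ℝ} (hv0 : v ≠ 0) {ℓ s : ℝ}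
    (hℓ : v ⬝ᵥ (evenBlock w win *ᵥ v) ≤ ℓ * (v ⬝ᵥ v)) (hs : v ⬝ᵥ (signDiag (win.N + 1) *ᵥ v) ≤ s * (v ⬝ᵥ v))
    (hℓs : ℓ + (1 - K) * w p * s < 0)
    (hsplit : ℓ - bottomRayleigh (evenBlock w win) < (-s - (2 * φ + φ ^ 2) * (2 * win.N + 1)) * ((1 - K) * w p)) :
    DetectablyNegative (datumOf (dial p K w)) ∧ ¬WindowPositive (datumOf (dial p K w) win) ∧
      datumOf (dial p K w) ∉ floorNodelessAt φ win ∧ datumOf (dial p K w) ∉ floorNodelessEOAt φ win := by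
  have hneg := downDial_negative_of_testBounds hp hwin w ht hv0 hℓ hs hℓs
  exact ⟨hneg.2, hneg.1, downDial_not_mem_floorNodelessAt_of_testVector hp hwin w hφ ht hv0 hℓ hs hsplit,
    downDial_not_mem_floorNodelessEOAt_of_testVector hp hwin w hφ ht hv0 hℓ hs hsplit⟩

/-- PROVED (`ζ` handle, down sign, `p` prime, `K ≤ 1`): the general-test-vector rejection + negativity for `w = zetaWeights`. [folklore] -/
theorem zeta_downDial_negative_and_rejected_gen {p : ℕ} (hp : p.Prime) {win : Window} (hwin : win.a = Real.log p)
    {K φ : ℝ} (hφ : 0 ≤ φ) (hK : K ≤ 1) {v : Fin (win.N + 1) → ℝ} (hv0 : v ≠ 0) {ℓ s : ℝ}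
    (hℓ : v ⬝ᵥ (evenBlock zetaWeights win *ᵥ v) ≤ ℓ * (v ⬝ᵥ v))
    (hs : v ⬝ᵥ (signDiag (win.N + 1) *ᵥ v) ≤ s * (v ⬝ᵥ v)) (hℓs : ℓ + (1 - K) * zetaWeights p * s < 0)
    (hsplit : ℓ - bottomRayleigh (evenBlock zetaWeights win)
      < (-s - (2 * φ + φ ^ 2) * (2 * win.N + 1)) * ((1 - K) * zetaWeights p)) :
    DetectablyNegative (datumOf (dial p K zetaWeights)) ∧ ¬WindowPositive (datumOf (dial p K zetaWeights) win) ∧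
      datumOf (dial p K zetaWeights) ∉ floorNodelessAt φ win ∧ datumOf (dial p K zetaWeights) ∉ floorNodelessEOAt φ win :=
  downDial_negative_and_rejected_gen hp.two_le hwin zetaWeights hφ
    (mul_nonneg (by linarith) (zetaWeights_pos_of_prime hp).le) hv0 hℓ hs hℓs hsplit

end Summit.RiemannHypothesis.RiemannHypothesis.Theorems.PfPersistence

end
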